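import Mathlib.NumberTheory.Primorial
import Mathlib.NumberTheory.PrimeCounting
import Mathlib.NumberTheory.Chebyshev
import Mathlib.NumberTheory.Divisors
import Mathlib.Data.Nat.Squarefree
import Mathlib.Data.Nat.Totient
import Mathlib.Data.Nat.Factorization.Basic
import Mathlib.Analysis.SpecialFunctions.Pow.Real
import Mathlib.Analysis.SpecialFunctions.Log.Monotone
import Mathlib.Combinatorics.Pigeonhole
import Mathlib.Analysis.Complex.ExponentialBounds
import Mathlib.Order.Filter.Cofinite
import HarnessLib

/-!
# Integers with many divisors of the form `p − 1` (Adleman–Pomerance–Rumely 1983, Proposition 10):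
# the counting argument, from a prime number theorem for progressions in the Linnik–Gallagher range

Topic `Literature/NumberTheory/Sieve`. THEOREMS only (no named fact is introduced).

Let `ω*(n) = #{d ∣ n : d + 1 prime}` be the number of divisors of `n` of the form `p − 1`
("shifted-prime divisors"). Prachar (1955) proved `ω*(n) > exp(c log n/(log log n)²)` infinitely
often; Adleman–Pomerance–Rumely (*On distinguishing prime numbers from composite numbers*, Ann. of
Math. 117 (1983), Proposition 10) improved this to

  `ω*(n) > exp(C log n / log log n)` for infinitely many `n`,

the maximal order up to the value of `C` (it matches Prachar's bound under GRH). This is the lemma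
"due to A. Odlyzko" on which McCurley's theorem on prime values of `xⁿ + a` rests
(`Literature.Barriers.Parity.McCurley1984_binomials`,
`Literature.Barriers.Parity.McCurley1984_binomials_of_shiftedPrimeDivisors`).

The proof has one analytic input — a lower bound of the right order for the number of primes
`p ≤ N`, `p ≡ 1 (mod d)`, for ALL moduli `d ≤ N^δ` not divisible by one exceptional modulus (the
prime number theorem for progressions in the Linnik–Gallagher range, Gallagher 1970 Theorem 7; in
the tree this is the content of the named fact
`Literature.NumberTheory.Sieve.MontgomeryVaughan1975.lemma43_gallagher`, see
`PrimesInAPGallagherRange.lean`) — and an elementary counting argument. THIS FILE proves the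
counting argument, with the analytic input as an explicit hypothesis (spelled out in the statement
of `infinite_setOf_exp_le_card_shiftedPrimeDivisors`; no `def` is made of it):

* (H) there are `c, δ > 0` and `N₀` such that for every `N ≥ N₀` there is an integer `b ≥ 2` with
  `#{p ≤ N prime : p ≡ 1 (mod d)} ≥ c N/(φ(d) log N)` for all `1 ≤ d ≤ N^δ` with `b ∤ d`.

## The counting argument (after Adleman–Pomerance–Rumely; as sketched in S. Fan, *The shifted
## prime-divisor function over shifted primes*, arXiv:2406.05217, §5, proof of Prop. 5.2)

Fix `N` large, let `k` be the product of the primes `p ≤ w = ⌊δ' log N/2⌋` (`δ' = min(δ, 1/2)`)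
other than the least prime factor of `b` — so `k` is squarefree, `k ≤ 4^w ≤ N^{δ'}`, no divisor of
`k` is a multiple of `b`, and `ω(k) ≥ π(w) − 1 ≫ log N/log log N`. Count the pairs `(m, p)`,
`m ≤ N`, `p ≤ N` prime, with `k ∣ m(p − 1)`: for each `d ∣ k` the pairs with `d ∣ p − 1`,
`(k/d) ∣ m`, `(m, d) = 1` are at least `φ(d)⌊N/k⌋ · cN/(φ(d) log N)` in number (APR's
`A(k, 1, ∞) ≫ (x²/(k log x)) ∑_{d ∣ k} φ(d)/d`, here without the squarefree restriction on `p − 1`),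
and these families are disjoint (`d` is determined by `m`), so there are `≥ τ(k) ⌊N/k⌋ cN/log N`
pairs; the products `n = m(p − 1) ≤ N²` are multiples of `k`, of which there are `≤ N²/k`; hence
(pigeonhole) some `n ≤ N²` arises from `≥ c τ(k)/(2 log N) − 1` pairs, whose primes `p` are
distinct and satisfy `p − 1 ∣ n`: `ω*(n) ≥ c 2^{ω(k)}/(2 log N) − 1 ≥ exp(C log n/log log n)`
with `C = δ' log 2/32`, and `n ≥ k → ∞`.

Main statements: `exists_card_shiftedPrimeDivisors_gt` (the count for one `N` and one squarefree
`k`), `infinite_setOf_exp_le_card_shiftedPrimeDivisors` ((H) ⟹ APR Proposition 10, in the form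
consumed by `McCurley1984_binomials_of_shiftedPrimeDivisors`).

## References

* L. M. Adleman, C. Pomerance, R. S. Rumely, *On distinguishing prime numbers from composite
  numbers*, Ann. of Math. 117 (1983) 173–206, Proposition 10 [AdlemanPomeranceRumely1983].
* S. Fan, *The shifted prime-divisor function over shifted primes*, arXiv:2406.05217 (2024), §1
  and §5 (proof sketch of Proposition 5.2, after [APR]).
* P. X. Gallagher, *A large sieve density estimate near `σ = 1`*, Invent. Math. 11 (1970),
  Theorem 7 [Gallagher1970].
-/

noncomputable section

open Finset Real Filter

namespace Literature.NumberTheory.Sieve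

namespace ShiftedPrimeDivisors

/-! ### Elementary counting lemmas -/

/-- `τ(k) = 2^{ω(k)}` for squarefree `k` (a private copy of
`Literature.NumberTheory.Sieve.card_divisors_of_squarefree`, to keep the import closure small).
[folklore] -/
private theorem card_divisors_eq_two_pow {k : ℕ} (hk : Squarefree k) :
    k.divisors.card = 2 ^ k.primeFactors.card := by
  rw [Nat.card_divisors hk.ne_zero, ← Finset.prod_const]
  refine Finset.prod_congr rfl fun p hp => ?_
  have h1 : k.factorization p ≤ 1 := Squarefree.natFactorization_le_one p hk
  have h2 : 0 < k.factorization p :=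
    (Nat.prime_of_mem_primeFactors hp).factorization_pos_of_dvd hk.ne_zero
      (Nat.dvd_of_mem_primeFactors hp)
  omega

/-- In `Q` full periods there are exactly `Q φ(d)` integers coprime to `d`:
`#{1 ≤ t ≤ Qd : (d, t) = 1} = Q φ(d)`. [folklore] -/
theorem card_filter_coprime_Ioc_mul (d Q : ℕ) :
    ((Ioc 0 (Q * d)).filter (fun t => d.Coprime t)).card = Q * d.totient := by
  induction Q with
  | zero => simp
  | succ Q ih =>
    have hsplit : Ioc 0 ((Q + 1) * d) = Ioc 0 (Q * d) ∪ Ioc (Q * d) (Q * d + d) := by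
      rw [add_mul, one_mul, Finset.Ioc_union_Ioc_eq_Ioc (Nat.zero_le _) (Nat.le_add_right _ _)]
    have hdisj : Disjoint ((Ioc 0 (Q * d)).filter (fun t => d.Coprime t))
        ((Ioc (Q * d) (Q * d + d)).filter (fun t => d.Coprime t)) :=
      disjoint_filter_filter (Finset.disjoint_left.mpr fun t h1 h2 => by
        simp only [mem_Ioc] at h1 h2; omega)
    rw [hsplit, filter_union, card_union_of_disjoint hdisj, ih, add_mul, one_mul]
    congr 1
    have : Ioc (Q * d) (Q * d + d) = Ico (Q * d + 1) (Q * d + 1 + d) := by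
      ext t; simp only [mem_Ioc, mem_Ico]; omega
    rw [this, Nat.filter_coprime_Ico_eq_totient]

/-! ### The count for one `N` -/

/-- **The pigeonhole count** (Adleman–Pomerance–Rumely 1983, proof of Proposition 10, for one
`x = N` and one squarefree `k` with `2k ≤ N`). If for every `d ∣ k` there are at least
`c N/(φ(d) log N)` primes `p ≤ N` with `p ≡ 1 (mod d)`, then some positive multiple `n ≤ N²` of
`k` has more than `c 2^{ω(k)}/(2 log N) − 1` divisors `t` with `t + 1` prime. (Pairs `(m, p)`,
`m = (k/d)t`, `t ≤ ⌊N/k⌋d`, `(t, d) = 1`, `p ≡ 1 (mod d)`: at least `τ(k)⌊N/k⌋cN/log N` of them,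
disjointly in `d`; their products `m(p − 1) ≤ N²` are multiples of `k`, at most `N²/k` in
number; a popular product `n` has `≥ c τ(k)/(2 log N) − 1` representations with distinct `p`,
`p − 1 ∣ n`.) [cite: AdlemanPomeranceRumely1983, Proposition 10 (proof)] -/
theorem exists_card_shiftedPrimeDivisors_gt {N k : ℕ} {c : ℝ} (hk : Squarefree k)
    (h2k : 2 * k ≤ N)
    (hAP : ∀ d ∈ k.divisors, c * N / (Nat.totient d * Real.log N) ≤
      (((Finset.Iic N).filter (fun p => p.Prime ∧ p ≡ 1 [MOD d])).card : ℝ)) :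
    ∃ n : ℕ, k ∣ n ∧ 0 < n ∧ n ≤ N * N ∧
      c * 2 ^ k.primeFactors.card / (2 * Real.log N) - 1 <
        ((n.divisors.filter (fun t => (t + 1).Prime)).card : ℝ) := by
  classical
  have hk0 : 0 < k := Nat.pos_of_ne_zero hk.ne_zero
  have hkN : k ≤ N := by omega
  have hN2 : 2 ≤ N := by omega
  set Q : ℕ := N / k with hQ
  -- the sets of pairs
  set M : ℕ → Finset ℕ := fun d =>
    ((Ioc 0 (Q * d)).filter (fun t => d.Coprime t)).image (fun t => k / d * t) with hM
  set P : ℕ → Finset ℕ := fun d => (Iic N).filter (fun p => p.Prime ∧ p ≡ 1 [MOD d]) with hP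
  set A : Finset (ℕ × ℕ) := k.divisors.biUnion (fun d => M d ×ˢ P d) with hA
  set T : Finset ℕ := (Ioc 0 (N * N)).filter (fun n => k ∣ n) with hT
  set F : ℕ × ℕ → ℕ := fun x => x.1 * (x.2 - 1) with hF
  -- divisors of `k`
  have hdiv : ∀ d ∈ k.divisors, 0 < d ∧ d ∣ k ∧ 0 < k / d ∧ k / d * d = k ∧ (k / d).Coprime d := by
    intro d hd
    have hdk : d ∣ k := Nat.dvd_of_mem_divisors hd
    have hd0 : 0 < d := Nat.pos_of_mem_divisors hd
    have hkd : k / d * d = k := Nat.div_mul_cancel hdk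
    refine ⟨hd0, hdk, Nat.div_pos (Nat.le_of_dvd hk0 hdk) hd0, hkd, ?_⟩
    exact Nat.coprime_of_squarefree_mul (hkd.symm ▸ hk)
  -- members of `M d`
  have hmemM : ∀ d ∈ k.divisors, ∀ m ∈ M d,
      0 < m ∧ m ≤ N ∧ k / d ∣ m ∧ m.Coprime d := by
    intro d hd m hm
    obtain ⟨hd0, hdk, hkd0, hkd, hcop⟩ := hdiv d hd
    obtain ⟨t, ht, rfl⟩ := Finset.mem_image.mp hm
    obtain ⟨ht1, ht2⟩ := Finset.mem_filter.mp ht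
    obtain ⟨ht0, htQ⟩ := Finset.mem_Ioc.mp ht1
    refine ⟨Nat.mul_pos hkd0 ht0, ?_, Dvd.intro t rfl, Nat.Coprime.mul_left hcop ht2.symm⟩
    calc k / d * t ≤ k / d * (Q * d) := Nat.mul_le_mul_left _ htQ
      _ = Q * (k / d * d) := by ring
      _ = Q * k := by rw [hkd]
      _ ≤ N := Nat.div_mul_le_self N k
  -- `#M d = Q φ(d)`
  have hcardM : ∀ d ∈ k.divisors, (M d).card = Q * d.totient := by
    intro d hd
    obtain ⟨-, -, hkd0, -, -⟩ := hdiv d hd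
    rw [Finset.card_image_of_injective _ (mul_right_injective₀ hkd0.ne'),
      card_filter_coprime_Ioc_mul]
  -- the families are disjoint: `d` is determined by `m`
  have hdet : ∀ d ∈ k.divisors, ∀ d' ∈ k.divisors, ∀ m, m ∈ M d → m ∈ M d' → d ∣ d' := by
    intro d hd d' hd' m hm hm'
    obtain ⟨-, hdk, -, -, -⟩ := hdiv d hd
    obtain ⟨-, -, -, hkd', -⟩ := hdiv d' hd'
    obtain ⟨-, -, -, hcopm⟩ := hmemM d hd m hm
    obtain ⟨-, -, hdvd', -⟩ := hmemM d' hd' m hm'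
    have hcop : d.Coprime (k / d') := (Nat.Coprime.coprime_dvd_left hdvd' hcopm).symm
    have : d ∣ d' * (k / d') := by rw [mul_comm, hkd']; exact hdk
    exact hcop.dvd_of_dvd_mul_right this
  have hdisj : (k.divisors : Set ℕ).PairwiseDisjoint (fun d => M d ×ˢ P d) := by
    intro d hd d' hd' hne
    refine Finset.disjoint_left.mpr fun x hx hx' => hne ?_
    obtain ⟨hm, -⟩ := Finset.mem_product.mp hx
    obtain ⟨hm', -⟩ := Finset.mem_product.mp hx'
    exact Nat.dvd_antisymm (hdet d hd d' hd' x.1 hm hm') (hdet d' hd' d hd x.1 hm' hm)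
  -- the number of pairs
  have hcardA : (A.card : ℝ) = ∑ d ∈ k.divisors, ((Q * d.totient : ℕ) : ℝ) * (P d).card := by
    rw [hA, Finset.card_biUnion hdisj]
    push_cast
    refine Finset.sum_congr rfl fun d hd => ?_
    rw [Finset.card_product, hcardM d hd]; push_cast; ring
  -- pairs give multiples of `k` in `(0, N²]`
  have hmaps : ∀ x ∈ A, F x ∈ T := by
    intro x hx
    obtain ⟨d, hd, hx⟩ := Finset.mem_biUnion.mp hx
    obtain ⟨hm, hp⟩ := Finset.mem_product.mp hx
    obtain ⟨hm0, hmN, hdvd, -⟩ := hmemM d hd x.1 hm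
    obtain ⟨hpN, hpp, hp1⟩ := by simpa [hP] using hp
    obtain ⟨-, -, -, hkd, -⟩ := hdiv d hd
    have hp2 : 2 ≤ x.2 := hpp.two_le
    have hd1 : d ∣ x.2 - 1 := (Nat.modEq_iff_dvd' (by omega)).mp hp1.symm
    refine Finset.mem_filter.mpr ⟨Finset.mem_Ioc.mpr ⟨?_, ?_⟩, ?_⟩
    · exact Nat.mul_pos hm0 (by omega)
    · exact Nat.mul_le_mul hmN (by omega)
    · rw [← hkd]; exact mul_dvd_mul hdvd hd1
  have hTne : T.Nonempty := ⟨k, Finset.mem_filter.mpr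
    ⟨Finset.mem_Ioc.mpr ⟨hk0, hkN.trans (Nat.le_mul_self N)⟩, dvd_rfl⟩⟩
  have hcardT : T.card = N * N / k := Nat.Ioc_filter_dvd_card_eq_div (N * N) k
  -- real numbers
  have hN0 : (0 : ℝ) < N := by exact_mod_cast (show 0 < N by omega)
  have hlogN : 0 < Real.log N := Real.log_pos (by exact_mod_cast (show 1 < N by omega))
  have hτ : (k.divisors.card : ℝ) = 2 ^ k.primeFactors.card := by
    rw [card_divisors_eq_two_pow hk]; push_cast; ring
  set B : ℝ := c * 2 ^ k.primeFactors.card / (2 * Real.log N) with hB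
  -- trivial case `B ≤ 0`
  rcases le_or_gt B 0 with hB0 | hB0
  · refine ⟨k, dvd_rfl, hk0, hkN.trans (Nat.le_mul_self N), ?_⟩
    have : (0 : ℝ) ≤ ((k.divisors.filter (fun t => (t + 1).Prime)).card : ℝ) := Nat.cast_nonneg _
    linarith
  have hc : 0 < c := by
    by_contra hc
    push Not at hc
    have : B ≤ 0 := by
      rw [hB]; exact div_nonpos_of_nonpos_of_nonneg
        (mul_nonpos_of_nonpos_of_nonneg hc (by positivity)) (by positivity)
    linarith
  -- lower bound for the number of pairs: `#A ≥ τ(k) Q c N / log N`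
  have hAlow : (2 : ℝ) ^ k.primeFactors.card * (Q * (c * N / Real.log N)) ≤ A.card := by
    rw [hcardA, ← hτ]
    have : ∑ d ∈ k.divisors, ((Q : ℝ) * (c * N / Real.log N)) =
        (k.divisors.card : ℝ) * (Q * (c * N / Real.log N)) := by
      rw [Finset.sum_const, nsmul_eq_mul]
    rw [← this]
    refine Finset.sum_le_sum fun d hd => ?_
    obtain ⟨hd0, -, -, -, -⟩ := hdiv d hd
    have hφ : (0 : ℝ) < d.totient := by exact_mod_cast Nat.totient_pos.mpr hd0
    have h1 := hAP d hd
    calc (Q : ℝ) * (c * N / Real.log N)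
        = ((Q * d.totient : ℕ) : ℝ) * (c * N / (d.totient * Real.log N)) := by
          push_cast; field_simp
      _ ≤ ((Q * d.totient : ℕ) : ℝ) * ((P d).card : ℝ) :=
          mul_le_mul_of_nonneg_left h1 (Nat.cast_nonneg _)
  -- upper bound for the number of targets: `#T ≤ N²/k`, and `Q k ≥ N − k ≥ N/2`
  have hTup : (T.card : ℝ) ≤ (N : ℝ) * N / k := by
    rw [hcardT]; exact_mod_cast Nat.cast_div_le
  have hQk : (N : ℝ) / 2 ≤ (Q : ℝ) * k := by
    have h1 : N < N / k * k + k := Nat.lt_div_mul_add (by omega)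
    have h2 : ((N : ℕ) : ℝ) < ((N / k * k + k : ℕ) : ℝ) := by exact_mod_cast h1
    push_cast at h2
    have h3 : (2 * k : ℝ) ≤ N := by exact_mod_cast h2k
    rw [hQ]; linarith
  -- `#T · B ≤ #A`
  have hkey : (T.card : ℝ) * B ≤ A.card := by
    have hk0' : (0 : ℝ) < k := by exact_mod_cast hk0
    calc (T.card : ℝ) * B ≤ (N : ℝ) * N / k * B := mul_le_mul_of_nonneg_right hTup hB0.le
      _ = 2 ^ k.primeFactors.card * ((N / 2) / k * (c * N / Real.log N)) := by
          rw [hB]; field_simp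
      _ ≤ 2 ^ k.primeFactors.card * (Q * (c * N / Real.log N)) := by
          gcongr
          rw [div_le_iff₀ hk0']; exact hQk
      _ ≤ A.card := hAlow
  have hkey' : T.card * ⌊B⌋₊ ≤ A.card := by
    have h1 : (⌊B⌋₊ : ℝ) ≤ B := Nat.floor_le hB0.le
    have h2 : (T.card : ℝ) * ⌊B⌋₊ ≤ A.card :=
      (mul_le_mul_of_nonneg_left h1 (Nat.cast_nonneg _)).trans hkey
    exact_mod_cast h2
  -- pigeonhole
  obtain ⟨n, hnT, hfib⟩ := Finset.exists_le_card_fiber_of_mul_le_card_of_maps_to hmaps hTne hkey'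
  obtain ⟨hn1, hkn⟩ := Finset.mem_filter.mp hnT
  obtain ⟨hn0, hnN⟩ := Finset.mem_Ioc.mp hn1
  refine ⟨n, hkn, hn0, hnN, ?_⟩
  -- the fibre injects into the shifted-prime divisors of `n`
  have hinj : (A.filter (fun x => F x = n)).card ≤ (n.divisors.filter (fun t => (t + 1).Prime)).card := by
    refine Finset.card_le_card_of_injOn (fun x => x.2 - 1) (fun x hx => ?_) ?_
    · obtain ⟨hxA, hxn⟩ := Finset.mem_filter.mp hx
      obtain ⟨d, hd, hx'⟩ := Finset.mem_biUnion.mp hxA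
      obtain ⟨-, hp⟩ := Finset.mem_product.mp hx'
      obtain ⟨-, hpp, -⟩ := by simpa [hP] using hp
      have hp2 : 2 ≤ x.2 := hpp.two_le
      refine Finset.mem_coe.mpr (Finset.mem_filter.mpr ⟨Nat.mem_divisors.mpr ⟨?_, by omega⟩, ?_⟩)
      · rw [← hxn, hF]; exact Dvd.intro_left _ rfl
      · rw [Nat.sub_add_cancel (by omega)]; exact hpp
    · intro x hx y hy hxy
      obtain ⟨hxA, hxn⟩ := Finset.mem_filter.mp (Finset.mem_coe.mp hx)
      obtain ⟨hyA, hyn⟩ := Finset.mem_filter.mp (Finset.mem_coe.mp hy)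
      obtain ⟨d, hd, hx'⟩ := Finset.mem_biUnion.mp hxA
      obtain ⟨-, hp⟩ := Finset.mem_product.mp hx'
      obtain ⟨-, hpp, -⟩ := by simpa [hP] using hp
      obtain ⟨d', hd', hy'⟩ := Finset.mem_biUnion.mp hyA
      obtain ⟨-, hq⟩ := Finset.mem_product.mp hy'
      obtain ⟨-, hqp, -⟩ := by simpa [hP] using hq
      have hp2 : 2 ≤ x.2 := hpp.two_le
      have hq2 : 2 ≤ y.2 := hqp.two_le
      have h2 : x.2 = y.2 := by simp only at hxy; omega
      have h1 : x.1 = y.1 := by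
        have : x.1 * (x.2 - 1) = y.1 * (x.2 - 1) := by
          have := hxn.trans hyn.symm; simp only [hF] at this; rwa [← h2] at this
        exact Nat.eq_of_mul_eq_mul_right (by omega) this
      exact Prod.ext h1 h2
  have hfloor : B - 1 < (⌊B⌋₊ : ℝ) := by
    have := Nat.lt_floor_add_one B; linarith
  calc B - 1 < (⌊B⌋₊ : ℝ) := hfloor
    _ ≤ ((A.filter (fun x => F x = n)).card : ℝ) := by exact_mod_cast hfib
    _ ≤ _ := by exact_mod_cast hinj

/-! ### Chebyshev's bound and the growth lemma -/

/-- **Chebyshev's lower bound**, `π(w) ≥ w/(4 log w)` for `w ≥ 4` (from Mathlib's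
`Chebyshev.pi_ge`: `π(n) ≥ (n log 2 − log(n + 1))/log n`, and `log(w + 1) ≤ (w + 1)/8 − 1 + log 8`).
A copy of `Literature.NumberTheory.Sieve.SmoothLHalf.div_four_mul_log_le_primeCounting`, not
imported to keep the import closure small. [folklore] -/
private theorem div_four_mul_log_le_primeCounting {w : ℕ} (hw : 4 ≤ w) :
    (w : ℝ) / (4 * Real.log w) ≤ Nat.primeCounting w := by
  have hw' : (4 : ℝ) ≤ w := by exact_mod_cast hw
  have hlogw : 0 < Real.log w := Real.log_pos (by linarith)
  have h2 := Real.log_two_gt_d9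
  have h2' := Real.log_two_lt_d9
  have hlog : Real.log ((w : ℝ) + 1) ≤ ((w : ℝ) + 1) / 8 - 1 + 3 * Real.log 2 := by
    have h8 : Real.log ((w : ℝ) + 1) = Real.log (((w : ℝ) + 1) / 8) + Real.log 8 := by
      rw [← Real.log_mul (by positivity) (by norm_num), div_mul_cancel₀ _ (by norm_num)]
    have h8' : Real.log (8 : ℝ) = 3 * Real.log 2 := by
      rw [show (8 : ℝ) = 2 ^ 3 by norm_num, Real.log_pow]; norm_num
    rw [h8, h8']
    linarith [Real.log_le_sub_one_of_pos (show (0 : ℝ) < ((w : ℝ) + 1) / 8 by positivity)]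
  have hmain : (w : ℝ) / 4 ≤ (w * Real.log 2 - Real.log (w + 1)) := by nlinarith
  calc (w : ℝ) / (4 * Real.log w) = ((w : ℝ) / 4) / Real.log w := by rw [div_div]
    _ ≤ (w * Real.log 2 - Real.log (w + 1)) / Real.log w :=
        div_le_div_of_nonneg_right hmain hlogw.le
    _ ≤ Nat.primeCounting w := Chebyshev.pi_ge w

/-- For `a > 0` and any `K`: eventually `K + log L ≤ a L/log L` (`(log L)² = o(L)`). [folklore] -/
theorem eventually_add_log_le_mul_div_log {a : ℝ} (ha : 0 < a) (K : ℝ) :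
    ∀ᶠ L : ℝ in atTop, K + Real.log L ≤ a * L / Real.log L := by
  have h1 : ∀ᶠ L : ℝ in atTop, ‖Real.log L ^ 2‖ ≤ a / (|K| + 1) * ‖L‖ :=
    (Real.isLittleO_pow_log_id_atTop (n := 2)).def (by positivity)
  filter_upwards [h1, eventually_ge_atTop (Real.exp 1)] with L hL hLe
  have hL0 : 0 < L := (Real.exp_pos 1).trans_le hLe
  have hlog1 : 1 ≤ Real.log L := by
    rw [← Real.log_exp 1]; exact Real.log_le_log (Real.exp_pos 1) hLe
  rw [Real.norm_of_nonneg (by positivity), Real.norm_of_nonneg hL0.le] at hL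
  rw [le_div_iff₀ (by linarith)]
  have hK : K ≤ |K| := le_abs_self K
  have h2 : (K + Real.log L) * Real.log L ≤ (|K| + 1) * Real.log L ^ 2 := by
    have e1 : K * Real.log L ≤ |K| * Real.log L := mul_le_mul_of_nonneg_right hK (by linarith)
    have e2 : |K| * Real.log L ≤ |K| * Real.log L ^ 2 :=
      mul_le_mul_of_nonneg_left (by nlinarith) (abs_nonneg K)
    have e3 : (K + Real.log L) * Real.log L = K * Real.log L + Real.log L ^ 2 := by ring
    have e4 : (|K| + 1) * Real.log L ^ 2 = |K| * Real.log L ^ 2 + Real.log L ^ 2 := by ring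
    linarith
  have h3 : (|K| + 1) * Real.log L ^ 2 ≤ a * L := by
    have := mul_le_mul_of_nonneg_left hL (show (0 : ℝ) ≤ |K| + 1 by positivity)
    rwa [← mul_assoc, mul_div_cancel₀ _ (by positivity : (|K| + 1 : ℝ) ≠ 0)] at this
  linarith

/-- `t ↦ t/log t` is monotone on `[e, ∞)` (Mathlib: `log t/t` is antitone there). [folklore] -/
private theorem div_log_le_div_log {s t : ℝ} (hs : Real.exp 1 ≤ s) (hst : s ≤ t) :
    s / Real.log s ≤ t / Real.log t := by
  have hs0 : 0 < s := (Real.exp_pos 1).trans_le hs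
  have ht0 : 0 < t := hs0.trans_le hst
  have hlogs : 0 < Real.log s := by
    have : 1 ≤ Real.log s := by rw [← Real.log_exp 1]; exact Real.log_le_log (Real.exp_pos 1) hs
    linarith
  have hlogt : 0 < Real.log t := hlogs.trans_le (Real.log_le_log hs0 hst)
  have h := Real.log_div_self_antitoneOn hs (hs.trans hst) hst
  -- `log t / t ≤ log s / s`
  rw [div_le_div_iff₀ hlogs hlogt]
  rw [div_le_div_iff₀ ht0 hs0] at h
  linarith

/-! ### Three numerical lemmas -/

/-- `4^w ≤ N^{δ₁}` when `2w ≤ δ₁ log N` (`4 ≤ e²`). [folklore] -/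
theorem four_pow_le_rpow {N w : ℕ} {δ₁ : ℝ} (hN : 0 < N) (hw : 2 * (w : ℝ) ≤ δ₁ * Real.log N) :
    ((4 ^ w : ℕ) : ℝ) ≤ (N : ℝ) ^ δ₁ := by
  have he := Real.exp_one_gt_d9
  have h4 : (4 : ℝ) ≤ Real.exp 2 := by
    have : Real.exp 2 = Real.exp 1 * Real.exp 1 := by rw [← Real.exp_add]; norm_num
    nlinarith
  have hN0 : (0 : ℝ) < N := by exact_mod_cast hN
  calc ((4 ^ w : ℕ) : ℝ) = (4 : ℝ) ^ w := by push_cast; ring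
    _ ≤ (Real.exp 2) ^ w := pow_le_pow_left₀ (by norm_num) h4 w
    _ = Real.exp (w * 2) := (Real.exp_nat_mul 2 w).symm
    _ ≤ Real.exp (δ₁ * Real.log N) := Real.exp_le_exp.mpr (by linarith)
    _ = (N : ℝ) ^ δ₁ := by rw [Real.rpow_def_of_pos hN0, mul_comm]

/-- If `(δ₁L/2 − 1)/(4ℓ) − 1 ≤ s` and `ℓ ≥ 1` then `exp(δ₁ (log 2) L/(16 ℓ))²/4 ≤ 2^s`
(`2^s = exp(s log 2)`, `log 2/(4ℓ) ≤ log 2`). [folklore] -/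
theorem sq_exp_div_four_le_two_pow {δ₁ L ℓ : ℝ} {s : ℕ} (hℓ : 1 ≤ ℓ)
    (hs : (δ₁ * L / 2 - 1) / (4 * ℓ) - 1 ≤ s) :
    Real.exp (δ₁ * Real.log 2 / 8 * L / (2 * ℓ)) ^ 2 / 4 ≤ (2 : ℝ) ^ s := by
  have hlog2 : 0 < Real.log 2 := Real.log_pos (by norm_num)
  have hℓ0 : 0 < ℓ := by linarith
  have h2pow : (2 : ℝ) ^ s = Real.exp (s * Real.log 2) := by
    rw [← Real.rpow_natCast, Real.rpow_def_of_pos (by norm_num), mul_comm]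
  have h4 : (4 : ℝ) = Real.exp (2 * Real.log 2) := by
    rw [show (2 : ℝ) * Real.log 2 = Real.log (2 ^ 2) by rw [Real.log_pow]; norm_num,
      Real.exp_log (by norm_num)]; norm_num
  rw [h2pow, h4, ← Real.exp_nat_mul, ← Real.exp_sub]
  refine Real.exp_le_exp.mpr ?_
  have h1 : ((δ₁ * L / 2 - 1) / (4 * ℓ) - 1) * Real.log 2 ≤ s * Real.log 2 :=
    mul_le_mul_of_nonneg_right hs hlog2.le
  have h2 : ((2 : ℕ) : ℝ) * (δ₁ * Real.log 2 / 8 * L / (2 * ℓ)) - 2 * Real.log 2 =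
      ((δ₁ * L / 2 - 1) / (4 * ℓ) - 1) * Real.log 2 + (Real.log 2 / (4 * ℓ) - Real.log 2) := by
    push_cast; field_simp; ring
  have h3 : Real.log 2 / (4 * ℓ) ≤ Real.log 2 := by
    rw [div_le_iff₀ (by positivity)]; nlinarith
  rw [h2]; linarith

/-- If `16 L ≤ c X`, `X ≥ 1` and `X²/4 ≤ P` then `X ≤ cP/(2L) − 1` (`c, L > 0`). [folklore] -/
theorem le_sub_one_of_sixteen_mul_le {c L X P : ℝ} (hc : 0 < c) (hL : 0 < L) (hX : 1 ≤ X)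
    (h16 : 16 * L ≤ c * X) (hP : X ^ 2 / 4 ≤ P) : X ≤ c * P / (2 * L) - 1 := by
  have h1 : c * (X ^ 2 / 4) / (2 * L) ≤ c * P / (2 * L) := by gcongr
  have h2 : 2 * X ≤ c * (X ^ 2 / 4) / (2 * L) := by
    rw [le_div_iff₀ (by positivity)]
    nlinarith [mul_le_mul_of_nonneg_left h16 (show (0 : ℝ) ≤ X by linarith)]
  linarith

/-! ### Adleman–Pomerance–Rumely, Proposition 10, from the hypothesis (H) -/

/-- **One step of the construction** (Adleman–Pomerance–Rumely 1983, proof of Proposition 10):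
at a level `N ≥ 16` with `log N ≥ 4`, `w = ⌊δ₁ log N/2⌋ ≥ 4` (`0 < δ₁ ≤ min(δ, 1/2)`),
`log(16/c) + log log N ≤ (δ₁ log 2/16) log N/log log N` and `π(w) ≥ A + 6`, if the primes
`p ≤ N`, `p ≡ 1 (mod d)` number at least `cN/(φ(d) log N)` for every `1 ≤ d ≤ N^δ` not divisible
by `b ≥ 2`, then some `n > A` has at least `exp((δ₁ log 2/32) log n/log log n)` divisors `t` with
`t + 1` prime. (`k` = product of the primes `≤ w` other than the least prime factor of `b`;
`exists_card_shiftedPrimeDivisors_gt`; Chebyshev.)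
[cite: AdlemanPomeranceRumely1983, Proposition 10 (proof)] -/
theorem exists_gt_exp_le_card {c δ δ₁ : ℝ} (hc : 0 < c) (hδ₁0 : 0 < δ₁) (hδ₁δ : δ₁ ≤ δ)
    (hδ₁h : δ₁ ≤ 1 / 2) {N : ℕ} (hN16 : 16 ≤ N) (hL4 : 4 ≤ Real.log N) {w : ℕ}
    (hw : w = ⌊δ₁ * Real.log N / 2⌋₊) (hw4 : 4 ≤ w)
    (hkey : Real.log (16 / c) + Real.log (Real.log N) ≤
      δ₁ * Real.log 2 / 16 * Real.log N / Real.log (Real.log N))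
    {b : ℕ} (hb2 : 2 ≤ b)
    (hAP : ∀ d : ℕ, 1 ≤ d → (d : ℝ) ≤ (N : ℝ) ^ δ → ¬ b ∣ d →
      c * N / (Nat.totient d * Real.log N) ≤
        (((Finset.Iic N).filter (fun p => p.Prime ∧ p ≡ 1 [MOD d])).card : ℝ))
    {A : ℕ} (hπA : A + 6 ≤ Nat.primeCounting w) :
    ∃ n : ℕ, A < n ∧ Real.exp (δ₁ * Real.log 2 / 32 * Real.log n / Real.log (Real.log n)) ≤
      ((n.divisors.filter fun d => (d + 1).Prime).card : ℝ) := by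
  classical
  have hlog2 := Real.log_two_gt_d9
  -- the data at `N`
  set q : ℕ := b.minFac with hq
  have hqp : q.Prime := Nat.minFac_prime (by omega)
  set S : Finset ℕ := (Nat.primesLE w).erase q with hS
  have hSp : ∀ p ∈ S, p.Prime := fun p hp => Nat.prime_of_mem_primesLE (Finset.mem_of_mem_erase hp)
  set k : ℕ := ∏ p ∈ S, p with hk
  have hkprim : k ∣ primorial w := by
    rw [primorial_eq_prod_primesLE]
    exact Finset.prod_dvd_prod_of_subset _ _ _ (Finset.erase_subset _ _)
  have hksq : Squarefree k := (squarefree_primorial w).squarefree_of_dvd hkprim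
  have hk0 : 0 < k := Nat.pos_of_ne_zero hksq.ne_zero
  have hkpf : k.primeFactors = S := Nat.primeFactors_prod hSp
  have hcardS : Nat.primeCounting w - 1 ≤ S.card := by
    rw [hS, ← Nat.primesLE_card_eq_primeCounting]; exact Finset.pred_card_le_card_erase
  -- real parameters
  set L : ℝ := Real.log N with hL
  set ℓ : ℝ := Real.log L with hℓ
  have hN0 : (0 : ℝ) < N := by exact_mod_cast (show 0 < N by omega)
  have hN1 : (1 : ℝ) ≤ N := by exact_mod_cast (show 1 ≤ N by omega)
  have hL0 : 0 < L := by linarith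
  have hℓ1 : 1 < ℓ := by
    rw [hℓ, ← Real.log_exp 1]
    refine Real.log_lt_log (Real.exp_pos 1) (lt_of_lt_of_le ?_ hL4)
    have := Real.exp_one_lt_d9; linarith
  have hℓ0 : 0 < ℓ := by linarith
  -- `k ≤ 4^w ≤ N^{δ₁} ≤ √N`, so `2k ≤ N`
  have hwle : (w : ℝ) ≤ δ₁ * L / 2 := by rw [hw]; exact Nat.floor_le (by positivity)
  have hwlow : δ₁ * L / 2 - 1 < w := by rw [hw]; exact Nat.sub_one_lt_floor _
  have hkle : (k : ℝ) ≤ (N : ℝ) ^ δ₁ := by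
    have h1 : k ≤ 4 ^ w := (Nat.le_of_dvd (primorial_pos _) hkprim).trans (primorial_le_four_pow _)
    have h2 : (k : ℝ) ≤ ((4 ^ w : ℕ) : ℝ) := by exact_mod_cast h1
    exact h2.trans (four_pow_le_rpow (show 0 < N by omega) (by rw [← hL]; linarith))
  have h2k : 2 * k ≤ N := by
    have hks : (k : ℝ) ≤ Real.sqrt N := by
      refine hkle.trans ?_
      rw [Real.sqrt_eq_rpow]
      exact Real.rpow_le_rpow_of_exponent_le hN1 hδ₁h
    have hs2 : 2 ≤ Real.sqrt N := by
      have h4 : Real.sqrt 4 = 2 := by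
        rw [show (4 : ℝ) = 2 ^ 2 by norm_num, Real.sqrt_sq (by norm_num)]
      rw [← h4]
      exact Real.sqrt_le_sqrt (by exact_mod_cast (show 4 ≤ N by omega))
    have hss : Real.sqrt N * Real.sqrt N = N := Real.mul_self_sqrt hN0.le
    have h3 : 2 * Real.sqrt N ≤ Real.sqrt N * Real.sqrt N :=
      mul_le_mul_of_nonneg_right hs2 (Real.sqrt_nonneg _)
    have : 2 * (k : ℝ) ≤ N := by linarith
    exact_mod_cast this
  -- every `d ∣ k` is `≤ N^δ` and not a multiple of `b`
  have hAPk : ∀ d ∈ k.divisors, c * N / (Nat.totient d * Real.log N) ≤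
      (((Finset.Iic N).filter (fun p => p.Prime ∧ p ≡ 1 [MOD d])).card : ℝ) := by
    intro d hd
    have hdk : d ∣ k := Nat.dvd_of_mem_divisors hd
    have hd0 : 0 < d := Nat.pos_of_mem_divisors hd
    refine hAP d hd0 ?_ ?_
    · have : (d : ℝ) ≤ k := by exact_mod_cast Nat.le_of_dvd hk0 hdk
      exact this.trans (hkle.trans (Real.rpow_le_rpow_of_exponent_le hN1 hδ₁δ))
    · intro hbd
      have hqk : q ∣ k := (Nat.minFac_dvd b).trans (hbd.trans hdk)
      obtain ⟨p, hp, hqp'⟩ := (Prime.dvd_finsetProd_iff hqp.prime _).mp hqk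
      have : q = p := (Nat.prime_dvd_prime_iff_eq hqp (hSp p hp)).mp hqp'
      exact (Finset.notMem_erase q _) (this ▸ hp : q ∈ S)
  -- the count
  obtain ⟨n, hkn, hn0, hnN, hcount⟩ := exists_card_shiftedPrimeDivisors_gt hksq h2k hAPk
  rw [hkpf] at hcount
  -- `n > A` and `n ≥ 32`: `n ≥ k ≥ 2^{#S} > #S ≥ π(w) − 1 ≥ A + 5`
  have h2S : 2 ^ S.card ≤ k := by
    rw [hk]; exact Finset.pow_card_le_prod S (fun p => p) 2 fun p hp => (hSp p hp).two_le
  have hkn' : k ≤ n := Nat.le_of_dvd hn0 hkn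
  have hnA : A < n := by
    have h2 : S.card < 2 ^ S.card := Nat.lt_two_pow_self
    omega
  have hn32 : 32 ≤ n := by
    have : 2 ^ 5 ≤ 2 ^ S.card := Nat.pow_le_pow_right (by norm_num) (by omega)
    omega
  refine ⟨n, hnA, ?_⟩
  -- sizes: `e ≤ log n ≤ 2L`
  have hn0' : (0 : ℝ) < n := by exact_mod_cast hn0
  have hlogn_le : Real.log n ≤ 2 * L := by
    have hn_le : (n : ℝ) ≤ (N : ℝ) ^ 2 := by exact_mod_cast (sq (N : ℕ) ▸ hnN : n ≤ N ^ 2)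
    calc Real.log n ≤ Real.log ((N : ℝ) ^ 2) := Real.log_le_log hn0' hn_le
      _ = 2 * L := by rw [Real.log_pow]; push_cast; rw [hL]
  have hlogn_ge : Real.exp 1 ≤ Real.log n := by
    have h32 : (32 : ℝ) ≤ n := by exact_mod_cast hn32
    have h1 : Real.log 32 ≤ Real.log n := Real.log_le_log (by norm_num) h32
    have h2 : Real.log (32 : ℝ) = 5 * Real.log 2 := by
      rw [show (32 : ℝ) = 2 ^ 5 by norm_num, Real.log_pow]; push_cast; ring
    have h3 := Real.exp_one_lt_d9
    linarith
  -- `X = exp(a₀ L/(2ℓ))`, `a₀ = δ₁ log 2/8`; `16 L ≤ c X`; `X²/4 ≤ 2^{#S}`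
  set X : ℝ := Real.exp (δ₁ * Real.log 2 / 8 * L / (2 * ℓ)) with hX
  have hX1 : 1 ≤ X := Real.one_le_exp (by positivity)
  have hLX : 16 * L ≤ c * X := by
    have h1 : Real.exp (Real.log (16 / c) + ℓ) ≤ X := by
      rw [hX]; refine Real.exp_le_exp.mpr ?_
      calc Real.log (16 / c) + ℓ ≤ δ₁ * Real.log 2 / 16 * Real.log N / Real.log (Real.log N) := hkey
        _ = δ₁ * Real.log 2 / 8 * L / (2 * ℓ) := by rw [hℓ, hL]; ring
    rw [Real.exp_add, Real.exp_log (by positivity), hℓ, Real.exp_log hL0] at h1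
    have h2 : 16 / c * L * c ≤ X * c := mul_le_mul_of_nonneg_right h1 hc.le
    calc 16 * L = 16 / c * L * c := by field_simp
      _ ≤ X * c := h2
      _ = c * X := mul_comm _ _
  have hpow : X ^ 2 / 4 ≤ (2 : ℝ) ^ S.card := by
    refine sq_exp_div_four_le_two_pow hℓ1.le ?_
    -- `π(w) ≥ w/(4 log w) ≥ w/(4ℓ) ≥ (δ₁ L/2 − 1)/(4ℓ)`
    have hw0 : (0 : ℝ) < w := by exact_mod_cast (show 0 < w by omega)
    have hwL : (w : ℝ) ≤ L := by nlinarith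
    have hlogw : Real.log w ≤ ℓ := by rw [hℓ]; exact Real.log_le_log hw0 hwL
    have hlogw0 : 0 < Real.log w := Real.log_pos (by exact_mod_cast (show 1 < w by omega))
    have hπ : (δ₁ * L / 2 - 1) / (4 * ℓ) ≤ Nat.primeCounting w := by
      calc (δ₁ * L / 2 - 1) / (4 * ℓ) ≤ (w : ℝ) / (4 * ℓ) :=
            div_le_div_of_nonneg_right hwlow.le (by positivity)
        _ ≤ (w : ℝ) / (4 * Real.log w) :=
            div_le_div_of_nonneg_left hw0.le (by positivity) (by linarith)
        _ ≤ Nat.primeCounting w := div_four_mul_log_le_primeCounting hw4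
    have h1 : ((Nat.primeCounting w - 1 : ℕ) : ℝ) ≤ S.card := by exact_mod_cast hcardS
    have h2 : ((Nat.primeCounting w - 1 : ℕ) : ℝ) = Nat.primeCounting w - 1 := by
      rw [Nat.cast_sub (by omega)]; push_cast; ring
    linarith
  -- assemble: `exp((a₀/4) log n/log log n) ≤ X ≤ c 2^{#S}/(2L) − 1 < count`
  have hstep1 : Real.exp (δ₁ * Real.log 2 / 32 * Real.log n / Real.log (Real.log n)) ≤ X := by
    rw [hX]; refine Real.exp_le_exp.mpr ?_
    have h1 : Real.log n / Real.log (Real.log n) ≤ 2 * L / Real.log (2 * L) :=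
      div_log_le_div_log hlogn_ge hlogn_le
    have h2 : 2 * L / Real.log (2 * L) ≤ 2 * L / ℓ := by
      refine div_le_div_of_nonneg_left (by positivity) hℓ0 ?_
      rw [hℓ]; exact Real.log_le_log hL0 (by linarith)
    have h3 : 0 ≤ δ₁ * Real.log 2 / 32 := by positivity
    calc δ₁ * Real.log 2 / 32 * Real.log n / Real.log (Real.log n)
        = δ₁ * Real.log 2 / 32 * (Real.log n / Real.log (Real.log n)) := by ring
      _ ≤ δ₁ * Real.log 2 / 32 * (2 * L / ℓ) := mul_le_mul_of_nonneg_left (h1.trans h2) h3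
      _ = δ₁ * Real.log 2 / 8 * L / (2 * ℓ) := by field_simp; ring
  have hstep2 : X ≤ c * 2 ^ S.card / (2 * Real.log N) - 1 :=
    le_sub_one_of_sixteen_mul_le hc hL0 hX1 hLX hpow
  exact hstep1.trans (hstep2.trans hcount.le)

/-- **Adleman–Pomerance–Rumely 1983, Proposition 10** (integers with
`exp(C log n/log log n)` divisors of the form `p − 1`), from the prime number theorem for
progressions in the Linnik–Gallagher range, stated as the explicit hypothesis (H): there are
`c, δ > 0`, `N₀` such that for every `N ≥ N₀` there is `b ≥ 2` with
`#{p ≤ N prime : p ≡ 1 (mod d)} ≥ cN/(φ(d) log N)` for all `1 ≤ d ≤ N^δ`, `b ∤ d` (Gallagher 1970,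
Theorem 7, the exceptional modulus being a multiple of `b`; in the tree, a consequence of
`Literature.NumberTheory.Sieve.MontgomeryVaughan1975.lemma43_gallagher`). CONCLUSION: there is
`C > 0` such that `#{d ∣ n : d + 1 prime} ≥ exp(C log n/log log n)` for infinitely many `n`
(`C = min(δ, 1/2) log 2/32`). Proof: `exists_gt_exp_le_card` at all large `N`.
[cite: AdlemanPomeranceRumely1983, Proposition 10] -/
theorem infinite_setOf_exp_le_card_shiftedPrimeDivisors
    (H : ∃ c : ℝ, 0 < c ∧ ∃ δ : ℝ, 0 < δ ∧ ∃ N₀ : ℕ, ∀ N : ℕ, N₀ ≤ N → ∃ b : ℕ, 2 ≤ b ∧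
      ∀ d : ℕ, 1 ≤ d → (d : ℝ) ≤ (N : ℝ) ^ δ → ¬ b ∣ d →
        c * N / (Nat.totient d * Real.log N) ≤
          (((Finset.Iic N).filter (fun p => p.Prime ∧ p ≡ 1 [MOD d])).card : ℝ)) :
    ∃ C : ℝ, 0 < C ∧ {n : ℕ | Real.exp (C * Real.log n / Real.log (Real.log n)) ≤
      ((n.divisors.filter fun d => (d + 1).Prime).card : ℝ)}.Infinite := by
  obtain ⟨c, hc, δ, hδ, N₀, hH⟩ := H
  set δ₁ : ℝ := min δ (1 / 2) with hδ₁
  have hδ₁0 : 0 < δ₁ := lt_min hδ (by norm_num)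
  have hδ₁δ : δ₁ ≤ δ := min_le_left _ _
  have hδ₁h : δ₁ ≤ 1 / 2 := min_le_right _ _
  have hlog2 : 0 < Real.log 2 := Real.log_pos (by norm_num)
  refine ⟨δ₁ * Real.log 2 / 32, by positivity, ?_⟩
  -- growth of `w = ⌊δ₁ log N / 2⌋` and `π(w)`
  have hlogN : Tendsto (fun N : ℕ => Real.log N) atTop atTop :=
    Real.tendsto_log_atTop.comp tendsto_natCast_atTop_atTop
  have hwt : Tendsto (fun N : ℕ => ⌊δ₁ * Real.log N / 2⌋₊) atTop atTop := by
    have h1 : Tendsto (fun N : ℕ => δ₁ * Real.log N / 2 + (-1)) atTop atTop :=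
      tendsto_atTop_add_const_right _ _ ((hlogN.const_mul_atTop hδ₁0).atTop_div_const (by norm_num))
    have h2 : Tendsto (fun N : ℕ => ((⌊δ₁ * Real.log N / 2⌋₊ : ℕ) : ℝ)) atTop atTop :=
      tendsto_atTop_mono (fun N => by
        have := Nat.sub_one_lt_floor (δ₁ * Real.log N / 2); linarith) h1
    exact tendsto_natCast_atTop_iff.mp h2
  have hπt : Tendsto (fun N : ℕ => Nat.primeCounting ⌊δ₁ * Real.log N / 2⌋₊) atTop atTop :=
    Nat.tendsto_primeCounting.comp hwt
  -- eventual properties of `N`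
  have hev : ∀ᶠ N : ℕ in atTop, N₀ ≤ N ∧ 16 ≤ N ∧ 4 ≤ Real.log N ∧ 4 ≤ ⌊δ₁ * Real.log N / 2⌋₊ ∧
      Real.log (16 / c) + Real.log (Real.log N) ≤
        δ₁ * Real.log 2 / 16 * Real.log N / Real.log (Real.log N) := by
    filter_upwards [eventually_ge_atTop N₀, eventually_ge_atTop 16,
      hlogN.eventually (eventually_ge_atTop 4), hwt.eventually (eventually_ge_atTop 4),
      hlogN.eventually (eventually_add_log_le_mul_div_log
        (by positivity : 0 < δ₁ * Real.log 2 / 16) (Real.log (16 / c)))] with N h1 h2 h3 h4 h5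
    exact ⟨h1, h2, h3, h4, h5⟩
  -- infinitely many `n`: for every `A` some good `n ≥ A`
  refine Nat.frequently_atTop_iff_infinite.mp (frequently_atTop.mpr fun A => ?_)
  obtain ⟨N, ⟨hN₀, hN16, hL4, hw4, hkey⟩, hπA⟩ :=
    (hev.and (hπt.eventually (eventually_ge_atTop (A + 6)))).exists
  obtain ⟨b, hb2, hAP⟩ := hH N hN₀
  obtain ⟨n, hnA, hn⟩ := exists_gt_exp_le_card hc hδ₁0 hδ₁δ hδ₁h hN16 hL4 rfl hw4 hkey hb2 hAP hπA
  exact ⟨n, hnA.le, hn⟩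

end ShiftedPrimeDivisors

end Literature.NumberTheory.Sieve
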